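import Summits.QuantumFields.YangMills.Theorems.UnitScaleTiltProp7HSplitDOfThreeRows
import Summits.QuantumFields.YangMills.Theorems.UnitScaleTiltProp7SliceOntoOfPlaqSmall
import HarnessLib

/-!
# Route `UnitScaleTilt`, crux K1 child «MinimiserStabilityRegPr» (stmt-QuantumFields-19200), skeleton v10, stub `stub_existenceMinimalOrbit` (EX), route (α) —
# **«P2CORE-OF-PLAQSMALL, FILE C» (px16 g4 LOCATE-HSPLIT-DESCENT v1.1 ecde23f5, cure (C1′); EX namer ★w2-19200 g7 (29) GO): `hSplitD` OF THE (P2-core) WITH THE CHART POINT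
# PLAQUETTE-REGULAR INSTEAD OF (19)-SIZED** — re-exports, with the SAME proofs, of ★w4-20520 g7∕g8's ✓`Prop7HSplitDOfPairing.hSplitD_of_pairing`, ✓`Prop7HSplitDOfRows.hDstar_of_nMax19_le`
# ∕ ✓`….htest_at_chart_of_rows` ∕ ✓`….hSplitD_of_rows` (✓p665110) and ✓`Prop7HSplitDOfThreeRows.hSplitD_of_threeRows` (✓p669060): statements VERBATIM except that the chart point's
# `hreg′ : RegPr ε₀′ U′` becomes `hplaq′ : PlaqSmall (regThreshold F n K ε₀′) U′` (any `ε₀′`, `10⁷L³ε₀′ ≤ 1`) and the (19)-size `hsize : nMax19 U₀ X < e` (which was read ONLY for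
# `RegPr (178(ε₀ + e)) (e^{iX}U₀)` via ✓`regPr_emb15_of_in19` and for the (D*) row's orders 0, 1) becomes the ORDER-1 row `hX1 : ‖(∇¹_{U₀}X)_{μμ}(x)‖ ≤ e·η²` (order 0, `‖χ(A′)‖ < e·η`, is
# ✓`chartPoint_su2_norm`); the (P1) input is FILE B ✓`Prop7SliceOntoOfPlaqSmall.exists_su2_slice_tangent_add_gaugeDir_of_QSym_eq_zero_of_plaqSmall`.  NO landed declaration is edited.
# WHY: at the EX display S21ᴸ the second-order members of the (19)-size of the chart exponent are available only through `hSplit[Lift]` itself (`hSize19'_of_rowsL` ⟸ `hΔsol` ⟸ `h128Δ`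
# ⟸ ✓p686481), whereas orders 0, 1 (★px18 ✓`orders01_of_eq111_T3`) and hence `PlaqSmall` of the chart point (★px16 g3 ✓`plaqSmall_expHermField_of_orders01_le`) come from the display's
# own rows — [Balaban1985RegularSpaces] Sect. D's input is (1.7), (1.9) its output.  The all-members knit (✓`exists_rowsY1_all` ∘ this) and the family door follow.

Cell `ym3-torus`, width seat `ym3-torus-px16` (gen 4).  THEOREMS ONLY (0 `def`, 0 `sorry`); `--supports stmt-QuantumFields-19200 --as helper`, count-neutral.  YM₃ on T³ is a ladder rung
(R3), not the Clay problem; nothing here claims the stub, the crux, d = 4 or the mass gap.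

References: T. Bałaban, CMP 99 (1985) 389–434 [Balaban1985BackgroundPropagators] ((3.3) p.391, (3.8) p.392, (3.13)–(3.15) p.393, (3.19)–(3.23) pp.393–394, (3.115) p.418); CMP 102 (1985)
277–309 [Balaban1985Variational] ((19) p.281, (44)–(51) pp.285–286, (82)–(83) p.290, Prop. 3 p.289, (112) p.294); CMP 98 (1985) 17–51 [Balaban1985Averaging] ((8)–(11) pp.18–19,
(32)–(34) pp.22–23, (97) p.32); CMP 99 (1985) 75–102 [Balaban1985RegularSpaces] ((1.7)+(1.9) p.77, Sect. D pp.89–95, Prop. 7 p.98).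
-/

set_option autoImplicit false

noncomputable section

open scoped InnerProductSpace Matrix.Norms.L2Operator Matrix BigOperators
open Filter Metric NormedSpace

namespace Summit.QuantumFields.YangMills.Theorems.Prop7HSplitDOfPlaqSmall

open Literature.Analysis.Calculus.ExpDifferential (ad gSer)
open Literature.MathematicalPhysics.QuantumFieldTheory.Balaban1983to89
open Literature.MathematicalPhysics.QuantumFieldTheory.Balaban1983to89.T3ContinuumYM3Torus
open T4Continuum BlockAveraging
open BlockAveraging (Idx)
open B7Prop1Explicit (U1 treeWord disp)
open B10Eq27TorusAxialLog (holT transl unitsField toUField)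
open B7TransferAnalyticMean (meanCLM)
open B15DeterminingSets (embIter)
open T3PrintedRegularMinimiser (RegPr)
open T3RegularMinimiser (regThreshold)
open T3SectALandauChart (In19 emb15 eta eta_pos bgUnits covGradT)
open B11Prop3Model (Dfix)
open B11Eq103H1Complex (SiteL2K BondL2K)
open Summit.QuantumFields.YangMills.Theorems.Prop8Chart (emlIterU)
open Summit.QuantumFields.YangMills.Theorems.Prop7SectET3Transport (periodsT3)
open Summit.QuantumFields.YangMills.Theorems.Prop7SymAvgTwSym (logChartTwS QTwS CmapTwS Chart47T3twS)
open Summit.QuantumFields.YangMills.Theorems.Prop7SymAvgGL (QSym)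
open Summit.QuantumFields.YangMills.Theorems.Prop7SectET3HilbertLetters (W₂ toL2 toL2S DL2 DstarL2 covLapSite)
open Summit.QuantumFields.YangMills.Theorems.Prop7SectET3GaugeProjector (NS)
open Summit.QuantumFields.YangMills.Theorems.Prop7SPrint (IsLandauPrintS)
open Summit.QuantumFields.YangMills.Theorems.Prop7TPrint (nMax19 expHermField)
open Summit.QuantumFields.YangMills.Theorems.Prop7NMax19Algebra (covGradT_smul_complex)
open Summit.QuantumFields.YangMills.Theorems.Prop7ChartVelocityDexp (isUnit_gSer_ad_neg)
open Summit.QuantumFields.YangMills.Theorems.Prop7GaugeDirRotationDivergence (norm_DstarL2_transfer_le)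
open Summit.QuantumFields.YangMills.Theorems.Prop7LandauTransversalityMarginSU2Chart (chartPoint_su2_norm hSplitP2_su2_of_pairing_exp)
open Summit.QuantumFields.YangMills.Theorems.Prop7LandauTransversalityPairing (htest_of_rows)
open Summit.QuantumFields.YangMills.Theorems.Prop7HSplitDOfRows (surjective_gSer_ad_neg)
open Summit.QuantumFields.YangMills.Theorems.Prop7NestedMeanParallelLift (hHZ_of_parallelLift)
open Summit.QuantumFields.YangMills.Theorems.Prop7NestedMeanTowerCloseness (hPoinc_of_regPr)
open Summit.QuantumFields.YangMills.Theorems.Prop7FibreELOfCritSplit (coe_emb15_expHermField)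
open Summit.QuantumFields.YangMills.Theorems.Prop7SliceOntoOfPlaqSmall (exists_su2_slice_tangent_add_gaugeDir_of_QSym_eq_zero_of_plaqSmall)

variable (F : T3Family) {n K : ℕ} (h : n ≤ K)

/-- ★ **THE (D*) ROW OF ✓`htest_of_rows` AT ANY BOND FIELD WITH ORDERS 0, 1 OF (19) AS HYPOTHESES (`‖A(b)‖ ≤ eη`, `‖(∇¹_{U₀}A)_{μμ}(x)‖ ≤ eη²`; = ✓`hDstar_of_nMax19_le` with its two (19)-clauses displayed — the second-order members of `nMax19` are never read), `10⁹L²e ≤ 1`, WITH RATE `a′ := 56e`**: for every `N, w` with `g(ad(−A(b)))w(b) = N(b₋) −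
e^{A(b)}(U₀(b)N(b₊)U₀(b)⋆)e^{−A(b)}` bondwise, `‖D*_{U₀}(toL2 w + η·D_{U₀}(toL2S N))‖ ≤ η·(56e)·(‖toL2S N‖ + ‖D_{U₀}(toL2S N)‖)`.  Proof: ✓`norm_DstarL2_transfer_le` (★w5-20520 g7) with `ε := e`
— its two (19)-clauses `‖A(b)‖ ≤ eη`, `‖(∇¹_{U₀}A)_{μμ}(x)‖ ≤ eη²` are ✓`norm_le_nMax19_mul_eta`∕✓`norm_covGradT_le_nMax19`, `eη ≤ ¼` since `e ≤ 10⁻⁹` — then `e^{eη}e^{eη} ≤ 2` and `12 + 100e ≤ 28`.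
[cite: Balaban1985BackgroundPropagators, (3.3) p.391, (3.8) p.392; Balaban1985Variational, (19) p.281, (47)–(49) p.285] -/
theorem hDstar_of_orders01 {c₀ : ℝ} [Fact (0 < c₀)] (U₀ : GaugeField (F.P K) 0 (Matrix.specialUnitaryGroup (Fin 2) ℂ))
    (A : PBond (F.P K) 0 → Matrix (Fin 2) (Fin 2) ℂ) {e : ℝ} (he : 0 ≤ e) (hA0 : ∀ b, ‖A b‖ ≤ e * eta F n K)
    (hA1 : ∀ (μ : Fin 3) (x : Site (F.P K) 0), ‖covGradT 1 (bgUnits F K U₀) A μ μ x‖ ≤ e * eta F n K ^ 2) (hWe : 10 ^ 9 * (F.L : ℝ) ^ 2 * e ≤ 1) :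
    ∀ (N : Site (F.P K) 0 → Matrix (Fin 2) (Fin 2) ℂ) (w : PBond (F.P K) 0 → Matrix (Fin 2) (Fin 2) ℂ),
      (∀ b, gSer ℂ (ad ℂ (-(A b))) (w b) = N b.src - exp (A b) * (((U₀ b : Matrix.specialUnitaryGroup (Fin 2) ℂ) : Matrix (Fin 2) (Fin 2) ℂ) * N b.tgt *
        star (((U₀ b) : Matrix.specialUnitaryGroup (Fin 2) ℂ) : Matrix (Fin 2) (Fin 2) ℂ)) * exp (-(A b))) →
      ‖DstarL2 F n K c₀ U₀ (toL2 F K c₀ w + ((eta F n K : ℝ) : ℂ) • DL2 F n K c₀ U₀ (toL2S F K c₀ N))‖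
        ≤ eta F n K * (56 * e) * (‖toL2S F K c₀ N‖ + ‖DL2 F n K c₀ U₀ (toL2S F K c₀ N)‖) := by
  intro N w hw
  have hη : 0 < eta F n K := eta_pos F n K
  have hL1 : (1 : ℝ) ≤ (F.L : ℝ) := by exact_mod_cast F.hL.2.le
  have hη1 : eta F n K ≤ 1 := by
    show ((F.L : ℝ)⁻¹) ^ (K - n) ≤ 1
    exact pow_le_one₀ (inv_nonneg.2 (by positivity)) (inv_le_one_of_one_le₀ hL1)
  have hL2 : (1 : ℝ) ≤ (F.L : ℝ) ^ 2 := one_le_pow₀ hL1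
  have he9 : e ≤ 1 / 10 ^ 9 := by
    have h1 : e ≤ (F.L : ℝ) ^ 2 * e := le_mul_of_one_le_left he hL2
    have h2 : (F.L : ℝ) ^ 2 * e ≤ 1 / 10 ^ 9 := by rw [le_div_iff₀ (by positivity)]; linarith
    exact h1.trans h2
  have heη9 : e * eta F n K ≤ 1 / 10 ^ 9 := (mul_le_of_le_one_right he hη1).trans he9
  have heη0 : 0 ≤ e * eta F n K := mul_nonneg he hη.le
  have heη : e * eta F n K ≤ 1 / 4 := by linarith
  refine (norm_DstarL2_transfer_le F U₀ A he hA0 heη hA1 N w hw).trans ?_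
  set a : ℝ := ‖toL2S F K c₀ N‖ with ha
  set d : ℝ := ‖DL2 F n K c₀ U₀ (toL2S F K c₀ N)‖ with hd
  have ha0 : 0 ≤ a := norm_nonneg _
  have hd0 : 0 ≤ d := norm_nonneg _
  -- `e^{eη}e^{eη} ≤ 2`
  have hX1 : Real.exp (e * eta F n K) ≤ 1 + 2 * (1 / 10 ^ 9) := by
    have h1 : |e * eta F n K| ≤ 1 := by rw [abs_of_nonneg heη0]; linarith
    have h2 := Real.abs_exp_sub_one_le h1
    rw [abs_of_nonneg heη0] at h2
    have h3 := (abs_le.1 h2).2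
    linarith
  have hX0 : 0 ≤ Real.exp (e * eta F n K) := (Real.exp_pos _).le
  have hX : Real.exp (e * eta F n K) * Real.exp (e * eta F n K) ≤ 2 := by nlinarith
  have h28 : 12 + 100 * e ≤ 28 := by linarith
  calc Real.exp (e * eta F n K) * Real.exp (e * eta F n K) * e * eta F n K * ((12 + 100 * e) * a + 28 * d)
      ≤ 2 * e * eta F n K * (28 * a + 28 * d) := by
        have h1 : (12 + 100 * e) * a + 28 * d ≤ 28 * a + 28 * d := by nlinarith
        have h2 : 0 ≤ (12 + 100 * e) * a + 28 * d := by positivity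
        calc Real.exp (e * eta F n K) * Real.exp (e * eta F n K) * e * eta F n K * ((12 + 100 * e) * a + 28 * d)
            = (Real.exp (e * eta F n K) * Real.exp (e * eta F n K)) * (e * eta F n K) * ((12 + 100 * e) * a + 28 * d) := by ring
          _ ≤ 2 * (e * eta F n K) * (28 * a + 28 * d) := by gcongr
          _ = 2 * e * eta F n K * (28 * a + 28 * d) := by ring
    _ = eta F n K * (56 * e) * (a + d) := by ring

/-- ★★★ **`hSplitD` FROM THE COMPLEX PAIRING TEST.**  In the (D47) window with `H` real, `h45L`, `A′` skew-Hermitian traceless (`2‖A′‖ < ε`), the chart point `U′ = e^{χ(A′)}U₀ ∈ 𝔘_k(ε₀′)`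
(`10⁷L³ε₀′ ≤ 1`) and the complex pairing test in the supplier's letters: for every Fréchet derivative `D` of `χ` at `A′`, every skew-Hermitian traceless `ξ` with `QSym(U′)ξ = 0` is
`ξ(b) = g(ad(−χ(A′)(b)))((Dδ)(b)) + (iN(b₋) − U′(b)·iN(b₊)·U′(b)⋆)` with `δ` skew-Hermitian traceless, `Q(U₀)δ = 0`, `IsLandauPrintS U₀ δ`, `N` Hermitian traceless.  Proof: (P1)
✓`exists_su2_slice_tangent_add_gaugeDir_of_QSym_eq_zero` gives `ξ = g(ad(−χA′))β′ + 𝒢_{U′}(iN′)` with `β′` an `𝔰𝔲(2)` twisted-slice tangent; (P2) ✓`hSplitP2_su2_of_pairing_exp` gives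
`g(ad(−χA′))β′ = g(ad(−χA′))(Dδ) + 𝒢_{U′}(iN₂)`; `N := N₂ + N′`.
[cite: Balaban1985Variational, (44)–(51) pp.285–286, (82)–(83) p.290, Prop. 3 p.289; Balaban1985Averaging, (11) p.19, (32)–(34) pp.22–23, (97) p.32; Balaban1985BackgroundPropagators, (3.3) p.391, (3.13)–(3.15) p.393, (3.20)–(3.23) p.394; Balaban1985RegularSpaces, Sect. D pp.89–95] -/
theorem hSplitD_of_pairing_of_plaqSmall [Fact (0 < (F.L : ℝ))] [Fact (0 < ((F.L : ℝ)⁻¹) ^ (K - n))] {c₀ cB : ℝ} [Fact (0 < c₀)] [Fact (0 < cB)]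
    {ε₀ ε₀' e b ε : ℝ} (hε₀ : 0 < ε₀) (he : 0 < e) (hWe : 10 ^ 9 * (F.L : ℝ) ^ 2 * e ≤ 1) (hWε : 10 ^ 12 * (F.L : ℝ) ^ 3 * ε₀ ≤ 1)
    (hε₀' : 0 < ε₀') (hε' : 10 ^ 7 * (F.L : ℝ) ^ 3 * ε₀' ≤ 1)
    (U₀ : GaugeField (F.P K) 0 (Matrix.specialUnitaryGroup (Fin 2) ℂ)) (hreg : RegPr F n K ε₀ U₀)
    {H : (PBond (F.P n) 0 → Matrix (Fin 2) (Fin 2) ℂ) →ₗ[ℂ] (PBond (F.P K) 0 → Matrix (Fin 2) (Fin 2) ℂ)} (hb : 0 ≤ b) (hHop : ∀ Y, ‖H Y‖ ≤ b * ‖Y‖)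
    (hHR : ∀ Y : PBond (F.P n) 0 → Matrix (Fin 2) (Fin 2) ℂ, (∀ c, star (Y c) = -Y c ∧ (Y c).trace = 0) → ∀ b', star (H Y b') = -H Y b' ∧ (H Y b').trace = 0)
    (hq : 9 * (40 * (2 * (3 * (2 * e + 2700 * (F.L : ℝ) * ε₀))) / (e * eta F n K) ^ 2) * b * ε < 1) (hRε : 6 * ε ≤ e * eta F n K)
    (h47 : Chart47T3twS F n K h (40 * (2 * (3 * (2 * e + 2700 * (F.L : ℝ) * ε₀))) / (e * eta F n K) ^ 2) ε U₀ H) (hQH : ∀ X, QTwS F n K h U₀ (H X) = X)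
    (h45L : ∀ Y, IsLandauPrintS F n K h c₀ cB U₀ (H Y))
    {A' : PBond (F.P K) 0 → Matrix (Fin 2) (Fin 2) ℂ} (hA' : 2 * ‖A'‖ < ε) (hA'R : ∀ b', star (A' b') = -A' b' ∧ (A' b').trace = 0)
    (U' : GaugeField (F.P K) 0 (Matrix.specialUnitaryGroup (Fin 2) ℂ)) (hplaq' : PlaqSmall (regThreshold F n K ε₀') U')
    (hU' : ∀ b, ((U' b : Matrix.specialUnitaryGroup (Fin 2) ℂ) : Matrix (Fin 2) (Fin 2) ℂ) = exp ((A' - H (Dfix (CmapTwS F n K h U₀) H (40 * (2 * (3 * (2 * e + 2700 * (F.L : ℝ) * ε₀))) / (e * eta F n K) ^ 2) A')) b) * ((U₀ b : Matrix.specialUnitaryGroup (Fin 2) ℂ) : Matrix (Fin 2) (Fin 2) ℂ))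
    (htest : ∀ l : Site (F.P K) 0 → Matrix (Fin 2) (Fin 2) ℂ, toL2S F K c₀ l ∈ NS F n K h c₀ cB U₀ →
      covLapSite F n K c₀ U₀ (toL2S F K c₀ l) ≠ 0 →
      ∃ (N'' : Site (F.P K) 0 → Matrix (Fin 2) (Fin 2) ℂ) (w : PBond (F.P K) 0 → Matrix (Fin 2) (Fin 2) ℂ),
        (∀ b, gSer ℂ (ad ℂ (-(A' - H (Dfix (CmapTwS F n K h U₀) H (40 * (2 * (3 * (2 * e + 2700 * (F.L : ℝ) * ε₀))) / (e * eta F n K) ^ 2) A')) b)) (w b) =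
          N'' b.src - exp ((A' - H (Dfix (CmapTwS F n K h U₀) H (40 * (2 * (3 * (2 * e + 2700 * (F.L : ℝ) * ε₀))) / (e * eta F n K) ^ 2) A')) b) * (((U₀ b : Matrix.specialUnitaryGroup (Fin 2) ℂ) : Matrix (Fin 2) (Fin 2) ℂ) * N'' b.tgt
            * star ((U₀ b : Matrix.specialUnitaryGroup (Fin 2) ℂ) : Matrix (Fin 2) (Fin 2) ℂ)) * exp (-(A' - H (Dfix (CmapTwS F n K h U₀) H (40 * (2 * (3 * (2 * e + 2700 * (F.L : ℝ) * ε₀))) / (e * eta F n K) ^ 2) A')) b)) ∧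
        fderiv ℂ (logChartTwS F n K h U₀) (A' - H (Dfix (CmapTwS F n K h U₀) H (40 * (2 * (3 * (2 * e + 2700 * (F.L : ℝ) * ε₀))) / (e * eta F n K) ^ 2) A')) w = 0 ∧
        ⟪toL2 F K c₀ w, DL2 F n K c₀ U₀ (covLapSite F n K c₀ U₀ (toL2S F K c₀ l))⟫_ℂ ≠ 0) :
    ∀ D : (PBond (F.P K) 0 → Matrix (Fin 2) (Fin 2) ℂ) →L[ℂ] (PBond (F.P K) 0 → Matrix (Fin 2) (Fin 2) ℂ),
      HasFDerivAt (fun A : PBond (F.P K) 0 → Matrix (Fin 2) (Fin 2) ℂ => A - H (Dfix (CmapTwS F n K h U₀) H (40 * (2 * (3 * (2 * e + 2700 * (F.L : ℝ) * ε₀))) / (e * eta F n K) ^ 2) A)) D A' →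
      ∀ ξ : PBond (F.P K) 0 → Matrix (Fin 2) (Fin 2) ℂ, (∀ b', star (ξ b') = -ξ b' ∧ (ξ b').trace = 0) →
      QSym F n K h U' ξ = 0 →
      ∃ δ : PBond (F.P K) 0 → Matrix (Fin 2) (Fin 2) ℂ, (∀ b', star (δ b') = -δ b' ∧ (δ b').trace = 0) ∧
        (QTwS F n K h U₀ δ = 0 ∧ IsLandauPrintS F n K h c₀ cB U₀ δ) ∧
        ∃ N : Site (F.P K) 0 → Matrix (Fin 2) (Fin 2) ℂ, (∀ x, (N x).IsHermitian ∧ (N x).trace = 0) ∧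
          ∀ b' : PBond (F.P K) 0, ξ b' = gSer ℂ (ad ℂ (-(A' - H (Dfix (CmapTwS F n K h U₀) H (40 * (2 * (3 * (2 * e + 2700 * (F.L : ℝ) * ε₀))) / (e * eta F n K) ^ 2) A')) b')) ((D δ) b')
            + (Complex.I • N b'.src - ((U' b' : Matrix.specialUnitaryGroup (Fin 2) ℂ) : Matrix (Fin 2) (Fin 2) ℂ) * (Complex.I • N b'.tgt) * star ((U' b' : Matrix.specialUnitaryGroup (Fin 2) ℂ) : Matrix (Fin 2) (Fin 2) ℂ)) := by
  intro D hD ξ hξR hξ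
  have hA'1 : ‖A'‖ < ε := by linarith [norm_nonneg A']
  obtain ⟨hA₁e, hA₁R, -⟩ := chartPoint_su2_norm F h hε₀ he hWe hWε U₀ hreg hb hHop hHR hq hRε h47 hA'1 hA'R
  -- (P1): `ξ = g(ad(−χA′))β′ + 𝒢_{U′}(iN′)`, `β′` an 𝔰𝔲(2) twisted-slice tangent
  obtain ⟨β', hβ'R, hβ', N', hN'R, hξeq⟩ := exists_su2_slice_tangent_add_gaugeDir_of_QSym_eq_zero_of_plaqSmall F h hε₀ he hWe hWε hε₀' hε' U₀ U' hreg hplaq' _ hA₁e hA₁R hU' ξ hξR hξ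
  -- (P2): `g(ad(−χA′))β′ = g(ad(−χA′))(Dδ) + 𝒢_{U′}(iN₂)`
  obtain ⟨δ, hδR, hQδ, hLδ, N₂, hN₂R, hsplit⟩ :=
    hSplitP2_su2_of_pairing_exp F h hε₀ he hWe hWε U₀ hreg hb hHop hHR hq hRε h47 hQH h45L hA' hA'R hD U' hU' htest β' hβ'R hβ'
  refine ⟨δ, hδR, ⟨hQδ, hLδ⟩, fun x => N₂ x + N' x, fun x => ⟨(hN₂R x).1.add (hN'R x).1, by rw [Matrix.trace_add, (hN₂R x).2, (hN'R x).2, add_zero]⟩, fun b' => ?_⟩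
  rw [hξeq b', hsplit b', smul_add, smul_add, Matrix.mul_add, Matrix.add_mul, add_assoc]
  congr 1
  abel

/-- ★★ **THE COMPLEX PAIRING TEST AT THE CHART POINT FROM THE FIVE DISPLAYED ROWS OF PLAN v2.**  Data: the (D47) window and `H`-letters of ✓`hSplitD_of_pairing` (`U₀ ∈ 𝔘_k(ε₀)`, `10⁹L²e ≤ 1`,
`10¹²L³ε₀ ≤ 1`, `‖HY‖ ≤ b‖Y‖`, `H` real, `9C₂ˢbε < 1`, `6ε ≤ eη`, `Chart47T3twS`), `A′` skew-Hermitian traceless with `2‖A′‖ < ε` and `χ(A′) = iX`, `nMax19 U₀ X < e`; an abstract sector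
`Z`, coarse currency `(Y, Kop, q)` with `Kop(a − b) = Kop a − Kop b`, constants `C₀, δ ≥ 0`, `P₂ ≥ 1`; the five rows of ✓`htest_of_rows` at `M b := g(ad(−χ(A′)(b)))`, `Gd N(b) := N(b₋) −
e^{χ(A′)(b)}(U₀(b)N(b₊)U₀(b)⋆)e^{−χ(A′)(b)}`, `T := D(log U̿^{twS})(χ(A′))`: (T) `hT`, (Q4-H²) `hQ4`, (T-small) `hKT`, (Poincaré) `hPoinc`, (H-Z) `hHZ`; the window `2(56e)(P₂ + C₀δ(2P₂)) +
C₀δ(2P₂) < 1`.  THEN for every residual `l` (`toL2S l ∈ N_S(U₀)`, `Δ^η_{U₀}l ≠ 0`) there are `N″, w` with `g(ad(−χ(A′)(b)))w(b) = Gd N″(b)`, `D(log U̿^{twS})(χ(A′)) w = 0` and `⟪toL2 w,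
D_{U₀}Δ^η_{U₀} l⟫ ≠ 0` — the `htest` hypothesis of ✓`hSplitD_of_pairing` VERBATIM.  Proof: ✓`htest_of_rows` with (D*) := §1 at `A := χ(A′)` and (M onto) := §2 (`‖χ(A′)(b)‖ ≤ ½`, ✓`chartPoint_su2_norm`).
[cite: Balaban1985BackgroundPropagators, (3.3) p.391, (3.20)–(3.23) p.394, (3.115) p.418; Balaban1985Variational, (19) p.281, (45) p.285, (47)–(51) pp.285–286, (82)–(83) p.290] -/
theorem htest_at_chart_of_rows_of_orders01 [Fact (0 < (F.L : ℝ))] [Fact (0 < ((F.L : ℝ)⁻¹) ^ (K - n))] {c₀ cB : ℝ} [Fact (0 < c₀)] [Fact (0 < cB)]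
    {ε₀ e b ε : ℝ} (hε₀ : 0 < ε₀) (he : 0 < e) (hWe : 10 ^ 9 * (F.L : ℝ) ^ 2 * e ≤ 1) (hWε : 10 ^ 12 * (F.L : ℝ) ^ 3 * ε₀ ≤ 1)
    (U₀ : GaugeField (F.P K) 0 (Matrix.specialUnitaryGroup (Fin 2) ℂ)) (hreg : RegPr F n K ε₀ U₀)
    {H : (PBond (F.P n) 0 → Matrix (Fin 2) (Fin 2) ℂ) →ₗ[ℂ] (PBond (F.P K) 0 → Matrix (Fin 2) (Fin 2) ℂ)} (hb : 0 ≤ b) (hHop : ∀ Y, ‖H Y‖ ≤ b * ‖Y‖)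
    (hHR : ∀ Y : PBond (F.P n) 0 → Matrix (Fin 2) (Fin 2) ℂ, (∀ c, star (Y c) = -Y c ∧ (Y c).trace = 0) → ∀ b', star (H Y b') = -H Y b' ∧ (H Y b').trace = 0)
    (hq : 9 * (40 * (2 * (3 * (2 * e + 2700 * (F.L : ℝ) * ε₀))) / (e * eta F n K) ^ 2) * b * ε < 1) (hRε : 6 * ε ≤ e * eta F n K)
    (h47 : Chart47T3twS F n K h (40 * (2 * (3 * (2 * e + 2700 * (F.L : ℝ) * ε₀))) / (e * eta F n K) ^ 2) ε U₀ H)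
    {A' : PBond (F.P K) 0 → Matrix (Fin 2) (Fin 2) ℂ} (hA' : 2 * ‖A'‖ < ε) (hA'R : ∀ b', star (A' b') = -A' b' ∧ (A' b').trace = 0)
    {X : PBond (F.P K) 0 → Matrix (Fin 2) (Fin 2) ℂ}
    (hAX : A' - H (Dfix (CmapTwS F n K h U₀) H (40 * (2 * (3 * (2 * e + 2700 * (F.L : ℝ) * ε₀))) / (e * eta F n K) ^ 2) A') = fun b' => Complex.I • X b')
    (hX1 : ∀ (μ : Fin 3) (x : Site (F.P K) 0), ‖covGradT 1 (bgUnits F K U₀) X μ μ x‖ ≤ e * eta F n K ^ 2)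
    (Z : (Site (F.P K) 0 → Matrix (Fin 2) (Fin 2) ℂ) → Prop)
    {Y : Type*} [AddCommGroup Y] (Kop : (Site (F.P K) 0 → Matrix (Fin 2) (Fin 2) ℂ) → Y) (q : Y → ℝ)
    (hKsub : ∀ a b : Site (F.P K) 0 → Matrix (Fin 2) (Fin 2) ℂ, Kop (a - b) = Kop a - Kop b)
    {C₀ δ P₂ : ℝ} (hC₀ : 0 ≤ C₀) (hδ : 0 ≤ δ) (h1 : 1 ≤ P₂)
    (hwin : 2 * (56 * e) * (P₂ + C₀ * δ * (2 * P₂)) + C₀ * δ * (2 * P₂) < 1)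
    (hT : ∀ (N' : Site (F.P K) 0 → Matrix (Fin 2) (Fin 2) ℂ) (w : PBond (F.P K) 0 → Matrix (Fin 2) (Fin 2) ℂ),
      (∀ b, gSer ℂ (ad ℂ (-(A' - H (Dfix (CmapTwS F n K h U₀) H (40 * (2 * (3 * (2 * e + 2700 * (F.L : ℝ) * ε₀))) / (e * eta F n K) ^ 2) A')) b)) (w b) =
        N' b.src - exp ((A' - H (Dfix (CmapTwS F n K h U₀) H (40 * (2 * (3 * (2 * e + 2700 * (F.L : ℝ) * ε₀))) / (e * eta F n K) ^ 2) A')) b) * (((U₀ b : Matrix.specialUnitaryGroup (Fin 2) ℂ) : Matrix (Fin 2) (Fin 2) ℂ) * N' b.tgt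
          * star ((U₀ b : Matrix.specialUnitaryGroup (Fin 2) ℂ) : Matrix (Fin 2) (Fin 2) ℂ)) * exp (-(A' - H (Dfix (CmapTwS F n K h U₀) H (40 * (2 * (3 * (2 * e + 2700 * (F.L : ℝ) * ε₀))) / (e * eta F n K) ^ 2) A')) b)) →
      Kop N' = 0 → fderiv ℂ (logChartTwS F n K h U₀) (A' - H (Dfix (CmapTwS F n K h U₀) H (40 * (2 * (3 * (2 * e + 2700 * (F.L : ℝ) * ε₀))) / (e * eta F n K) ^ 2) A')) w = 0)
    (hQ4 : ∀ m : Y, ∃ N : Site (F.P K) 0 → Matrix (Fin 2) (Fin 2) ℂ, Kop N = m ∧ ‖toL2S F K c₀ N‖ ≤ C₀ * q m ∧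
      ‖DL2 F n K c₀ U₀ (toL2S F K c₀ N)‖ ≤ C₀ * q m ∧ ‖covLapSite F n K c₀ U₀ (toL2S F K c₀ N)‖ ≤ C₀ * q m)
    (hKT : ∀ l₁ : Site (F.P K) 0 → Matrix (Fin 2) (Fin 2) ℂ, toL2S F K c₀ l₁ ∈ NS F n K h c₀ cB U₀ → Z l₁ →
      q (Kop l₁) ≤ δ * (‖toL2S F K c₀ l₁‖ + ‖DL2 F n K c₀ U₀ (toL2S F K c₀ l₁)‖))
    (hPoinc : ∀ l₁ : Site (F.P K) 0 → Matrix (Fin 2) (Fin 2) ℂ, toL2S F K c₀ l₁ ∈ NS F n K h c₀ cB U₀ → Z l₁ →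
      ‖toL2S F K c₀ l₁‖ ^ 2 ≤ P₂ * ‖DL2 F n K c₀ U₀ (toL2S F K c₀ l₁)‖ ^ 2)
    (hHZ : ∀ l : Site (F.P K) 0 → Matrix (Fin 2) (Fin 2) ℂ, toL2S F K c₀ l ∈ NS F n K h c₀ cB U₀ →
      ∃ l₁ : Site (F.P K) 0 → Matrix (Fin 2) (Fin 2) ℂ, toL2S F K c₀ l₁ ∈ NS F n K h c₀ cB U₀ ∧ Z l₁ ∧
        DL2 F n K c₀ U₀ (toL2S F K c₀ l₁) = DL2 F n K c₀ U₀ (toL2S F K c₀ l)) :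
    ∀ l : Site (F.P K) 0 → Matrix (Fin 2) (Fin 2) ℂ, toL2S F K c₀ l ∈ NS F n K h c₀ cB U₀ →
      covLapSite F n K c₀ U₀ (toL2S F K c₀ l) ≠ 0 →
      ∃ (N'' : Site (F.P K) 0 → Matrix (Fin 2) (Fin 2) ℂ) (w : PBond (F.P K) 0 → Matrix (Fin 2) (Fin 2) ℂ),
        (∀ b, gSer ℂ (ad ℂ (-(A' - H (Dfix (CmapTwS F n K h U₀) H (40 * (2 * (3 * (2 * e + 2700 * (F.L : ℝ) * ε₀))) / (e * eta F n K) ^ 2) A')) b)) (w b) =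
          N'' b.src - exp ((A' - H (Dfix (CmapTwS F n K h U₀) H (40 * (2 * (3 * (2 * e + 2700 * (F.L : ℝ) * ε₀))) / (e * eta F n K) ^ 2) A')) b) * (((U₀ b : Matrix.specialUnitaryGroup (Fin 2) ℂ) : Matrix (Fin 2) (Fin 2) ℂ) * N'' b.tgt
            * star ((U₀ b : Matrix.specialUnitaryGroup (Fin 2) ℂ) : Matrix (Fin 2) (Fin 2) ℂ)) * exp (-(A' - H (Dfix (CmapTwS F n K h U₀) H (40 * (2 * (3 * (2 * e + 2700 * (F.L : ℝ) * ε₀))) / (e * eta F n K) ^ 2) A')) b)) ∧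
        fderiv ℂ (logChartTwS F n K h U₀) (A' - H (Dfix (CmapTwS F n K h U₀) H (40 * (2 * (3 * (2 * e + 2700 * (F.L : ℝ) * ε₀))) / (e * eta F n K) ^ 2) A')) w = 0 ∧
        ⟪toL2 F K c₀ w, DL2 F n K c₀ U₀ (covLapSite F n K c₀ U₀ (toL2S F K c₀ l))⟫_ℂ ≠ 0 := by
  have hA'1 : ‖A'‖ < ε := by linarith [norm_nonneg A']
  obtain ⟨hA₁e, -, hA₁2⟩ := chartPoint_su2_norm F h hε₀ he hWe hWε U₀ hreg hb hHop hHR hq hRε h47 hA'1 hA'R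
  set A₁ : PBond (F.P K) 0 → Matrix (Fin 2) (Fin 2) ℂ :=
    A' - H (Dfix (CmapTwS F n K h U₀) H (40 * (2 * (3 * (2 * e + 2700 * (F.L : ℝ) * ε₀))) / (e * eta F n K) ^ 2) A') with hA₁def
  -- (M onto) and (D*) at the chart point
  have hMs : ∀ b', Function.Surjective ((gSer ℂ (ad ℂ (-A₁ b')) : Matrix (Fin 2) (Fin 2) ℂ →L[ℂ] Matrix (Fin 2) (Fin 2) ℂ)) :=
    fun b' => surjective_gSer_ad_neg (hA₁2 b')
  have hA₁0 : ∀ b, ‖A₁ b‖ ≤ e * eta F n K := fun b => (norm_le_pi_norm A₁ b).trans hA₁e.le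
  have hA₁1 : ∀ (μ : Fin 3) (x : Site (F.P K) 0), ‖covGradT 1 (bgUnits F K U₀) A₁ μ μ x‖ ≤ e * eta F n K ^ 2 := fun μ x => by
    have h1 : A₁ = Complex.I • X := by rw [hAX]; rfl
    rw [h1, covGradT_smul_complex, norm_smul, Complex.norm_I, one_mul]; exact hX1 μ x
  have hDstar := hDstar_of_orders01 F (c₀ := c₀) U₀ A₁ he.le hA₁0 hA₁1 hWe
  -- the consumer's letters `M`, `Gd`
  let M : PBond (F.P K) 0 → (Matrix (Fin 2) (Fin 2) ℂ →L[ℂ] Matrix (Fin 2) (Fin 2) ℂ) := fun b' => gSer ℂ (ad ℂ (-A₁ b'))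
  have hMdef : ∀ b' x, M b' x = gSer ℂ (ad ℂ (-A₁ b')) x := fun b' x => rfl
  let Gd : (Site (F.P K) 0 → Matrix (Fin 2) (Fin 2) ℂ) →ₗ[ℂ] (PBond (F.P K) 0 → Matrix (Fin 2) (Fin 2) ℂ) :=
    { toFun := fun N b' => N b'.src - exp (A₁ b') * (((U₀ b' : Matrix.specialUnitaryGroup (Fin 2) ℂ) : Matrix (Fin 2) (Fin 2) ℂ) * N b'.tgt
          * star ((U₀ b' : Matrix.specialUnitaryGroup (Fin 2) ℂ) : Matrix (Fin 2) (Fin 2) ℂ)) * exp (-A₁ b')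
      map_add' := fun N N' => by
        funext b'
        simp only [Pi.add_apply, Matrix.mul_add, Matrix.add_mul]
        abel
      map_smul' := fun z N => by
        funext b'
        simp only [Pi.smul_apply, RingHom.id_apply, smul_sub, Matrix.mul_smul, Matrix.smul_mul] }
  have hGd : ∀ N b', Gd N b' = N b'.src - exp (A₁ b') * (((U₀ b' : Matrix.specialUnitaryGroup (Fin 2) ℂ) : Matrix (Fin 2) (Fin 2) ℂ) * N b'.tgt
      * star ((U₀ b' : Matrix.specialUnitaryGroup (Fin 2) ℂ) : Matrix (Fin 2) (Fin 2) ℂ)) * exp (-A₁ b') := fun N b' => rfl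
  -- the rows in the letters `M`, `Gd`
  have hMs' : ∀ b', Function.Surjective (M b') := hMs
  have hT' : ∀ (N' : Site (F.P K) 0 → Matrix (Fin 2) (Fin 2) ℂ) (w : PBond (F.P K) 0 → Matrix (Fin 2) (Fin 2) ℂ),
      (∀ b', M b' (w b') = Gd N' b') → Kop N' = 0 → fderiv ℂ (logChartTwS F n K h U₀) A₁ w = 0 :=
    fun N' w hw hK => hT N' w (fun b' => by rw [← hMdef, ← hGd]; exact hw b') hK
  have hDstar' : ∀ (N' : Site (F.P K) 0 → Matrix (Fin 2) (Fin 2) ℂ) (w : PBond (F.P K) 0 → Matrix (Fin 2) (Fin 2) ℂ), (∀ b', M b' (w b') = Gd N' b') →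
      ‖DstarL2 F n K c₀ U₀ (toL2 F K c₀ w + ((eta F n K : ℝ) : ℂ) • DL2 F n K c₀ U₀ (toL2S F K c₀ N'))‖
        ≤ eta F n K * (56 * e) * (‖toL2S F K c₀ N'‖ + ‖DL2 F n K c₀ U₀ (toL2S F K c₀ N')‖) :=
    fun N' w hw => hDstar N' w (fun b' => by rw [← hMdef, ← hGd]; exact hw b')
  have ha' : (0 : ℝ) ≤ 56 * e := by positivity
  intro l hl hne
  obtain ⟨N', w, hMw, hTw, hp⟩ :=
    htest_of_rows F U₀ Z (T := fderiv ℂ (logChartTwS F n K h U₀) A₁) M hMs' Gd Kop q hKsub hT' ha' hC₀ hδ h1 hwin hDstar' hQ4 hKT hPoinc hHZ l hl hne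
  exact ⟨N', w, fun b' => by rw [← hMdef, ← hGd]; exact hMw b', hTw, hp⟩

/-- ★★★ **`hSplitD` FROM THE FIVE DISPLAYED ROWS OF PLAN v2** — the `hSplitD` hypothesis of ✓`Prop7FibreELOfCritSplitD.fibreEL_of_crit_splitD` VERBATIM at `Sl δ := (Q(U₀)δ = 0 ∧
IsLandauPrintS U₀ δ)`, over that consumer's own binders (`hw137 : 10⁷L³·178(ε₀ + e) ≤ 1`, `X` Hermitian traceless, `χ(A′) = iX`, `nMax19 U₀ X < e`), the (D47)∕`H`-letter binders of
✓`hSplitD_of_pairing` (`hQH`, `h45L` included) and the five rows (T) `hT`, (Q4-H²) `hQ4`, (T-small) `hKT`, (Poincaré) `hPoinc`, (H-Z) `hHZ` of ✓`htest_of_rows` at the chart letters, window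
`2(56e)(P₂ + C₀δ(2P₂)) + C₀δ(2P₂) < 1`: for every Fréchet derivative `D` of `χ` at `A′` and every skew-Hermitian traceless `ξ` with `QSym(e^{iX}U₀)ξ = 0` there are `δ′` skew-Hermitian traceless
with `Q(U₀)δ′ = 0`, `IsLandauPrintS U₀ δ′` and `N` Hermitian traceless with `ξ(b) = g(ad(−χ(A′)(b)))((Dδ′)(b)) + (iN(b₋) − (e^{iX}U₀)(b)·iN(b₊)·(e^{iX}U₀)(b)⋆)`.  Proof: ✓`hSplitD_of_pairing` at
`U′ := emb15 U₀ (expHermField X)` — `hU′` by ✓`coe_emb15_expHermField`, `RegPr (178(ε₀ + e)) U′` by ✓`in19_expHermField_of_nMax19_lt` ∘ ✓`regPr_emb15_of_in19` — fed by §3.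
[cite: Balaban1985Variational, (19) p.281, (44)–(51) pp.285–286, (82)–(83) p.290, Prop. 3 p.289, (112) p.294; Balaban1985BackgroundPropagators, (3.3) p.391, (3.13)–(3.15) p.393, (3.20)–(3.23) p.394, (3.115) p.418; Balaban1985Averaging, (32)–(34) pp.22–23, (97) p.32; Balaban1985RegularSpaces, Sect. D pp.89–95, Prop. 7 p.98] -/
theorem hSplitD_of_rows_of_plaqSmall [Fact (0 < (F.L : ℝ))] [Fact (0 < ((F.L : ℝ)⁻¹) ^ (K - n))] {c₀ cB : ℝ} [Fact (0 < c₀)] [Fact (0 < cB)]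
    {ε₀ e b ε : ℝ} (hε₀ : 0 < ε₀) (he : 0 < e) (hWe : 10 ^ 9 * (F.L : ℝ) ^ 2 * e ≤ 1) (hWε : 10 ^ 12 * (F.L : ℝ) ^ 3 * ε₀ ≤ 1)
    (U₀ : GaugeField (F.P K) 0 (Matrix.specialUnitaryGroup (Fin 2) ℂ)) (hreg : RegPr F n K ε₀ U₀)
    {H : (PBond (F.P n) 0 → Matrix (Fin 2) (Fin 2) ℂ) →ₗ[ℂ] (PBond (F.P K) 0 → Matrix (Fin 2) (Fin 2) ℂ)} (hb : 0 ≤ b) (hHop : ∀ Y, ‖H Y‖ ≤ b * ‖Y‖)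
    (hHR : ∀ Y : PBond (F.P n) 0 → Matrix (Fin 2) (Fin 2) ℂ, (∀ c, star (Y c) = -Y c ∧ (Y c).trace = 0) → ∀ b', star (H Y b') = -H Y b' ∧ (H Y b').trace = 0)
    (hq : 9 * (40 * (2 * (3 * (2 * e + 2700 * (F.L : ℝ) * ε₀))) / (e * eta F n K) ^ 2) * b * ε < 1) (hRε : 6 * ε ≤ e * eta F n K)
    (h47 : Chart47T3twS F n K h (40 * (2 * (3 * (2 * e + 2700 * (F.L : ℝ) * ε₀))) / (e * eta F n K) ^ 2) ε U₀ H) (hQH : ∀ X, QTwS F n K h U₀ (H X) = X)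
    (h45L : ∀ Y, IsLandauPrintS F n K h c₀ cB U₀ (H Y))
    {A' : PBond (F.P K) 0 → Matrix (Fin 2) (Fin 2) ℂ} (hA' : 2 * ‖A'‖ < ε) (hA'R : ∀ b', star (A' b') = -A' b' ∧ (A' b').trace = 0)
    {X : PBond (F.P K) 0 → Matrix (Fin 2) (Fin 2) ℂ} (hX : ∀ b, (X b).IsHermitian ∧ (X b).trace = 0)
    (hAX : A' - H (Dfix (CmapTwS F n K h U₀) H (40 * (2 * (3 * (2 * e + 2700 * (F.L : ℝ) * ε₀))) / (e * eta F n K) ^ 2) A') = fun b' => Complex.I • X b')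
    (hX1 : ∀ (μ : Fin 3) (x : Site (F.P K) 0), ‖covGradT 1 (bgUnits F K U₀) X μ μ x‖ ≤ e * eta F n K ^ 2)
    {ε₀' : ℝ} (hε₀' : 0 < ε₀') (hε' : 10 ^ 7 * (F.L : ℝ) ^ 3 * ε₀' ≤ 1) (hplaq' : PlaqSmall (regThreshold F n K ε₀') (emb15 U₀ (expHermField X)))
    (Z : (Site (F.P K) 0 → Matrix (Fin 2) (Fin 2) ℂ) → Prop)
    {Y : Type*} [AddCommGroup Y] (Kop : (Site (F.P K) 0 → Matrix (Fin 2) (Fin 2) ℂ) → Y) (q : Y → ℝ)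
    (hKsub : ∀ a b : Site (F.P K) 0 → Matrix (Fin 2) (Fin 2) ℂ, Kop (a - b) = Kop a - Kop b)
    {C₀ δ P₂ : ℝ} (hC₀ : 0 ≤ C₀) (hδ : 0 ≤ δ) (h1 : 1 ≤ P₂)
    (hwin : 2 * (56 * e) * (P₂ + C₀ * δ * (2 * P₂)) + C₀ * δ * (2 * P₂) < 1)
    (hT : ∀ (N' : Site (F.P K) 0 → Matrix (Fin 2) (Fin 2) ℂ) (w : PBond (F.P K) 0 → Matrix (Fin 2) (Fin 2) ℂ),
      (∀ b, gSer ℂ (ad ℂ (-(A' - H (Dfix (CmapTwS F n K h U₀) H (40 * (2 * (3 * (2 * e + 2700 * (F.L : ℝ) * ε₀))) / (e * eta F n K) ^ 2) A')) b)) (w b) =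
        N' b.src - exp ((A' - H (Dfix (CmapTwS F n K h U₀) H (40 * (2 * (3 * (2 * e + 2700 * (F.L : ℝ) * ε₀))) / (e * eta F n K) ^ 2) A')) b) * (((U₀ b : Matrix.specialUnitaryGroup (Fin 2) ℂ) : Matrix (Fin 2) (Fin 2) ℂ) * N' b.tgt
          * star ((U₀ b : Matrix.specialUnitaryGroup (Fin 2) ℂ) : Matrix (Fin 2) (Fin 2) ℂ)) * exp (-(A' - H (Dfix (CmapTwS F n K h U₀) H (40 * (2 * (3 * (2 * e + 2700 * (F.L : ℝ) * ε₀))) / (e * eta F n K) ^ 2) A')) b)) →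
      Kop N' = 0 → fderiv ℂ (logChartTwS F n K h U₀) (A' - H (Dfix (CmapTwS F n K h U₀) H (40 * (2 * (3 * (2 * e + 2700 * (F.L : ℝ) * ε₀))) / (e * eta F n K) ^ 2) A')) w = 0)
    (hQ4 : ∀ m : Y, ∃ N : Site (F.P K) 0 → Matrix (Fin 2) (Fin 2) ℂ, Kop N = m ∧ ‖toL2S F K c₀ N‖ ≤ C₀ * q m ∧
      ‖DL2 F n K c₀ U₀ (toL2S F K c₀ N)‖ ≤ C₀ * q m ∧ ‖covLapSite F n K c₀ U₀ (toL2S F K c₀ N)‖ ≤ C₀ * q m)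
    (hKT : ∀ l₁ : Site (F.P K) 0 → Matrix (Fin 2) (Fin 2) ℂ, toL2S F K c₀ l₁ ∈ NS F n K h c₀ cB U₀ → Z l₁ →
      q (Kop l₁) ≤ δ * (‖toL2S F K c₀ l₁‖ + ‖DL2 F n K c₀ U₀ (toL2S F K c₀ l₁)‖))
    (hPoinc : ∀ l₁ : Site (F.P K) 0 → Matrix (Fin 2) (Fin 2) ℂ, toL2S F K c₀ l₁ ∈ NS F n K h c₀ cB U₀ → Z l₁ →
      ‖toL2S F K c₀ l₁‖ ^ 2 ≤ P₂ * ‖DL2 F n K c₀ U₀ (toL2S F K c₀ l₁)‖ ^ 2)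
    (hHZ : ∀ l : Site (F.P K) 0 → Matrix (Fin 2) (Fin 2) ℂ, toL2S F K c₀ l ∈ NS F n K h c₀ cB U₀ →
      ∃ l₁ : Site (F.P K) 0 → Matrix (Fin 2) (Fin 2) ℂ, toL2S F K c₀ l₁ ∈ NS F n K h c₀ cB U₀ ∧ Z l₁ ∧
        DL2 F n K c₀ U₀ (toL2S F K c₀ l₁) = DL2 F n K c₀ U₀ (toL2S F K c₀ l)) :
    ∀ D : (PBond (F.P K) 0 → Matrix (Fin 2) (Fin 2) ℂ) →L[ℂ] (PBond (F.P K) 0 → Matrix (Fin 2) (Fin 2) ℂ),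
      HasFDerivAt (fun A : PBond (F.P K) 0 → Matrix (Fin 2) (Fin 2) ℂ =>
        A - H (Dfix (CmapTwS F n K h U₀) H (40 * (2 * (3 * (2 * e + 2700 * (F.L : ℝ) * ε₀))) / (e * eta F n K) ^ 2) A)) D A' →
      ∀ ξ : PBond (F.P K) 0 → Matrix (Fin 2) (Fin 2) ℂ, (∀ b', star (ξ b') = -ξ b' ∧ (ξ b').trace = 0) →
      QSym F n K h (emb15 U₀ (expHermField X)) ξ = 0 →
      ∃ δ' : PBond (F.P K) 0 → Matrix (Fin 2) (Fin 2) ℂ, (∀ b', star (δ' b') = -δ' b' ∧ (δ' b').trace = 0) ∧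
        (QTwS F n K h U₀ δ' = 0 ∧ IsLandauPrintS F n K h c₀ cB U₀ δ') ∧
        ∃ N : Site (F.P K) 0 → Matrix (Fin 2) (Fin 2) ℂ, (∀ x, (N x).IsHermitian ∧ (N x).trace = 0) ∧
          ∀ b' : PBond (F.P K) 0, ξ b' =
            gSer ℂ (ad ℂ (-(A' - H (Dfix (CmapTwS F n K h U₀) H (40 * (2 * (3 * (2 * e + 2700 * (F.L : ℝ) * ε₀))) / (e * eta F n K) ^ 2) A')) b'))
              ((D δ') b')
            + (Complex.I • N b'.src - ((emb15 U₀ (expHermField X) b' : Matrix.specialUnitaryGroup (Fin 2) ℂ) : Matrix (Fin 2) (Fin 2) ℂ) * (Complex.I • N b'.tgt)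
                * star ((emb15 U₀ (expHermField X) b' : Matrix.specialUnitaryGroup (Fin 2) ℂ) : Matrix (Fin 2) (Fin 2) ℂ)) := by
  -- the chart point `U′ := e^{iX}U₀` is printed-regular of radius `178(ε₀ + e)` ([Balaban1985RegularSpaces] Prop. 7 through (19))
  -- `U′(b) = e^{χ(A′)(b)}U₀(b)`
  have hU' : ∀ b', ((emb15 U₀ (expHermField X) b' : Matrix.specialUnitaryGroup (Fin 2) ℂ) : Matrix (Fin 2) (Fin 2) ℂ) =
      exp ((A' - H (Dfix (CmapTwS F n K h U₀) H (40 * (2 * (3 * (2 * e + 2700 * (F.L : ℝ) * ε₀))) / (e * eta F n K) ^ 2) A')) b') *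
        ((U₀ b' : Matrix.specialUnitaryGroup (Fin 2) ℂ) : Matrix (Fin 2) (Fin 2) ℂ) := fun b' => by
    rw [coe_emb15_expHermField F U₀ hX b', hAX]
  -- the door, fed by §3
  exact hSplitD_of_pairing_of_plaqSmall F h hε₀ he hWe hWε hε₀' hε' U₀ hreg hb hHop hHR hq hRε h47 hQH h45L hA' hA'R (emb15 U₀ (expHermField X)) hplaq' hU'
    (htest_at_chart_of_rows_of_orders01 F h hε₀ he hWe hWε U₀ hreg hb hHop hHR hq hRε h47 hA' hA'R hAX hX1 Z Kop q hKsub hC₀ hδ h1 hwin hT hQ4 hKT hPoinc hHZ)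

/-- ★★★ **`hSplitD` FROM THREE CURRENCY ROWS AND THE SECTOR RESIDUE `hLift`** — the `hSplitD` hypothesis of ✓`Prop7FibreELOfCritSplitD.fibreEL_of_crit_splitD` VERBATIM (at `Sl δ := (Q(U₀)δ = 0 ∧
IsLandauPrintS U₀ δ)`, `U′ := emb15 U₀ (expHermField X)`): ✓`Prop7HSplitDOfRows.hSplitD_of_rows` at `Z := «∃ ns, ns 0 = l₁ ∧ hsucc ∧ ns (K − n) = 0»`, `P₂ := 2`, (Poincaré) :=
✓`hPoinc_of_regPr` (★px11), (H-Z) := ✓`hHZ_of_parallelLift … hLift` (★px20); displayed: (T) `hT`, (Q4-H²) `hQ4`, (T-small on `Z`) `hKT` over an abstract coarse currency, `hLift`, and the window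
`2(56e)(2 + C₀δ(2·2)) + C₀δ(2·2) < 1`.
[cite: Balaban1985Variational, (19) p.281, (44)–(51) pp.285–286, (82)–(83) p.290, Prop. 3 p.289, (112) p.294; Balaban1985BackgroundPropagators, (3.3) p.391, (3.13)–(3.15) p.393, (3.19)–(3.23) pp.393–394, (3.115) p.418; Balaban1985Averaging, (8)–(11) pp.18–19, (32)–(34) pp.22–23, (97) p.32; Balaban1985RegularSpaces, Sect. D pp.89–95, Prop. 7 p.98] -/
theorem hSplitD_of_threeRows_of_plaqSmall [Fact (0 < (F.L : ℝ))] [Fact (0 < ((F.L : ℝ)⁻¹) ^ (K - n))] {c₀ cB : ℝ} [Fact (0 < c₀)] [Fact (0 < cB)]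
    {ε₀ e b ε : ℝ} (hε₀ : 0 < ε₀) (he : 0 < e) (hWe : 10 ^ 9 * (F.L : ℝ) ^ 2 * e ≤ 1) (hWε : 10 ^ 12 * (F.L : ℝ) ^ 3 * ε₀ ≤ 1)
    (U₀ : GaugeField (F.P K) 0 (Matrix.specialUnitaryGroup (Fin 2) ℂ)) (hreg : RegPr F n K ε₀ U₀)
    {H : (PBond (F.P n) 0 → Matrix (Fin 2) (Fin 2) ℂ) →ₗ[ℂ] (PBond (F.P K) 0 → Matrix (Fin 2) (Fin 2) ℂ)} (hb : 0 ≤ b) (hHop : ∀ Y, ‖H Y‖ ≤ b * ‖Y‖)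
    (hHR : ∀ Y : PBond (F.P n) 0 → Matrix (Fin 2) (Fin 2) ℂ, (∀ c, star (Y c) = -Y c ∧ (Y c).trace = 0) → ∀ b', star (H Y b') = -H Y b' ∧ (H Y b').trace = 0)
    (hq : 9 * (40 * (2 * (3 * (2 * e + 2700 * (F.L : ℝ) * ε₀))) / (e * eta F n K) ^ 2) * b * ε < 1) (hRε : 6 * ε ≤ e * eta F n K)
    (h47 : Chart47T3twS F n K h (40 * (2 * (3 * (2 * e + 2700 * (F.L : ℝ) * ε₀))) / (e * eta F n K) ^ 2) ε U₀ H) (hQH : ∀ X, QTwS F n K h U₀ (H X) = X)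
    (h45L : ∀ Y, IsLandauPrintS F n K h c₀ cB U₀ (H Y))
    {A' : PBond (F.P K) 0 → Matrix (Fin 2) (Fin 2) ℂ} (hA' : 2 * ‖A'‖ < ε) (hA'R : ∀ b', star (A' b') = -A' b' ∧ (A' b').trace = 0)
    {X : PBond (F.P K) 0 → Matrix (Fin 2) (Fin 2) ℂ} (hX : ∀ b, (X b).IsHermitian ∧ (X b).trace = 0)
    (hAX : A' - H (Dfix (CmapTwS F n K h U₀) H (40 * (2 * (3 * (2 * e + 2700 * (F.L : ℝ) * ε₀))) / (e * eta F n K) ^ 2) A') = fun b' => Complex.I • X b')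
    (hX1 : ∀ (μ : Fin 3) (x : Site (F.P K) 0), ‖covGradT 1 (bgUnits F K U₀) X μ μ x‖ ≤ e * eta F n K ^ 2)
    {ε₀' : ℝ} (hε₀' : 0 < ε₀') (hε' : 10 ^ 7 * (F.L : ℝ) ^ 3 * ε₀' ≤ 1) (hplaq' : PlaqSmall (regThreshold F n K ε₀') (emb15 U₀ (expHermField X)))
    (hLift : ∀ cf : Site (F.P K) (K - n) → Matrix (Fin 2) (Fin 2) ℂ,
      (∀ e' : PBond (F.P K) (K - n), cf e'.src = ((emlIterU (K - n) (bgUnits F K U₀) e' : (Matrix (Fin 2) (Fin 2) ℂ)ˣ) : Matrix (Fin 2) (Fin 2) ℂ) * cf e'.tgt *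
        (((emlIterU (K - n) (bgUnits F K U₀) e')⁻¹ : (Matrix (Fin 2) (Fin 2) ℂ)ˣ) : Matrix (Fin 2) (Fin 2) ℂ)) →
      ∃ l₀ : Site (F.P K) 0 → Matrix (Fin 2) (Fin 2) ℂ,
        (∀ b' : PBond (F.P K) 0, l₀ b'.src = ((bgUnits F K U₀ b' : (Matrix (Fin 2) (Fin 2) ℂ)ˣ) : Matrix (Fin 2) (Fin 2) ℂ) * l₀ b'.tgt * (((bgUnits F K U₀ b')⁻¹ : (Matrix (Fin 2) (Fin 2) ℂ)ˣ) : Matrix (Fin 2) (Fin 2) ℂ)) ∧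
        ∀ y : Site (F.P K) (K - n), l₀ (embIter (K - n) y) = cf y)
    {Y : Type*} [AddCommGroup Y] (Kop : (Site (F.P K) 0 → Matrix (Fin 2) (Fin 2) ℂ) → Y) (q : Y → ℝ)
    (hKsub : ∀ a b : Site (F.P K) 0 → Matrix (Fin 2) (Fin 2) ℂ, Kop (a - b) = Kop a - Kop b)
    {C₀ δ : ℝ} (hC₀ : 0 ≤ C₀) (hδ : 0 ≤ δ)
    (hwin : 2 * (56 * e) * (2 + C₀ * δ * (2 * 2)) + C₀ * δ * (2 * 2) < 1)
    (hT : ∀ (N' : Site (F.P K) 0 → Matrix (Fin 2) (Fin 2) ℂ) (w : PBond (F.P K) 0 → Matrix (Fin 2) (Fin 2) ℂ),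
      (∀ b, gSer ℂ (ad ℂ (-(A' - H (Dfix (CmapTwS F n K h U₀) H (40 * (2 * (3 * (2 * e + 2700 * (F.L : ℝ) * ε₀))) / (e * eta F n K) ^ 2) A')) b)) (w b) =
        N' b.src - exp ((A' - H (Dfix (CmapTwS F n K h U₀) H (40 * (2 * (3 * (2 * e + 2700 * (F.L : ℝ) * ε₀))) / (e * eta F n K) ^ 2) A')) b) * (((U₀ b : Matrix.specialUnitaryGroup (Fin 2) ℂ) : Matrix (Fin 2) (Fin 2) ℂ) * N' b.tgt
          * star ((U₀ b : Matrix.specialUnitaryGroup (Fin 2) ℂ) : Matrix (Fin 2) (Fin 2) ℂ)) * exp (-(A' - H (Dfix (CmapTwS F n K h U₀) H (40 * (2 * (3 * (2 * e + 2700 * (F.L : ℝ) * ε₀))) / (e * eta F n K) ^ 2) A')) b)) →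
      Kop N' = 0 → fderiv ℂ (logChartTwS F n K h U₀) (A' - H (Dfix (CmapTwS F n K h U₀) H (40 * (2 * (3 * (2 * e + 2700 * (F.L : ℝ) * ε₀))) / (e * eta F n K) ^ 2) A')) w = 0)
    (hQ4 : ∀ m : Y, ∃ N : Site (F.P K) 0 → Matrix (Fin 2) (Fin 2) ℂ, Kop N = m ∧ ‖toL2S F K c₀ N‖ ≤ C₀ * q m ∧
      ‖DL2 F n K c₀ U₀ (toL2S F K c₀ N)‖ ≤ C₀ * q m ∧ ‖covLapSite F n K c₀ U₀ (toL2S F K c₀ N)‖ ≤ C₀ * q m)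
    (hKT : ∀ l₁ : Site (F.P K) 0 → Matrix (Fin 2) (Fin 2) ℂ, toL2S F K c₀ l₁ ∈ NS F n K h c₀ cB U₀ →
      (∃ ns : (j : ℕ) → Site (F.P K) j → Matrix (Fin 2) (Fin 2) ℂ, ns 0 = l₁ ∧
        (∀ (j : ℕ) (y : Site (F.P K) (j + 1)), ns (j + 1) y = ns j (emb y) - meanCLM (Idx (F.P K)) (Matrix (Fin 2) (Fin 2) ℂ) fun i : Idx (F.P K) =>
          ns j (emb y) - ((holT (emlIterU j (bgUnits F K U₀)) (emb y) (stairWord i.2.1 (off i.1)) : (Matrix (Fin 2) (Fin 2) ℂ)ˣ) : Matrix (Fin 2) (Fin 2) ℂ) *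
            ns j (transl (emb y) (disp (stairWord i.2.1 (off i.1)))) * (((holT (emlIterU j (bgUnits F K U₀)) (emb y) (stairWord i.2.1 (off i.1)))⁻¹ : (Matrix (Fin 2) (Fin 2) ℂ)ˣ) : Matrix (Fin 2) (Fin 2) ℂ)) ∧
        ∀ y, ns (K - n) y = 0) →
      q (Kop l₁) ≤ δ * (‖toL2S F K c₀ l₁‖ + ‖DL2 F n K c₀ U₀ (toL2S F K c₀ l₁)‖)) :
    ∀ D : (PBond (F.P K) 0 → Matrix (Fin 2) (Fin 2) ℂ) →L[ℂ] (PBond (F.P K) 0 → Matrix (Fin 2) (Fin 2) ℂ),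
      HasFDerivAt (fun A : PBond (F.P K) 0 → Matrix (Fin 2) (Fin 2) ℂ =>
        A - H (Dfix (CmapTwS F n K h U₀) H (40 * (2 * (3 * (2 * e + 2700 * (F.L : ℝ) * ε₀))) / (e * eta F n K) ^ 2) A)) D A' →
      ∀ ξ : PBond (F.P K) 0 → Matrix (Fin 2) (Fin 2) ℂ, (∀ b', star (ξ b') = -ξ b' ∧ (ξ b').trace = 0) →
      QSym F n K h (emb15 U₀ (expHermField X)) ξ = 0 →
      ∃ δ' : PBond (F.P K) 0 → Matrix (Fin 2) (Fin 2) ℂ, (∀ b', star (δ' b') = -δ' b' ∧ (δ' b').trace = 0) ∧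
        (QTwS F n K h U₀ δ' = 0 ∧ IsLandauPrintS F n K h c₀ cB U₀ δ') ∧
        ∃ N : Site (F.P K) 0 → Matrix (Fin 2) (Fin 2) ℂ, (∀ x, (N x).IsHermitian ∧ (N x).trace = 0) ∧
          ∀ b' : PBond (F.P K) 0, ξ b' =
            gSer ℂ (ad ℂ (-(A' - H (Dfix (CmapTwS F n K h U₀) H (40 * (2 * (3 * (2 * e + 2700 * (F.L : ℝ) * ε₀))) / (e * eta F n K) ^ 2) A')) b'))
              ((D δ') b')
            + (Complex.I • N b'.src - ((emb15 U₀ (expHermField X) b' : Matrix.specialUnitaryGroup (Fin 2) ℂ) : Matrix (Fin 2) (Fin 2) ℂ) * (Complex.I • N b'.tgt)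
                * star ((emb15 U₀ (expHermField X) b' : Matrix.specialUnitaryGroup (Fin 2) ℂ) : Matrix (Fin 2) (Fin 2) ℂ)) := by
  have hL1 : (1 : ℝ) ≤ (F.L : ℝ) := by exact_mod_cast F.hL.2.le
  have hL3 : (1 : ℝ) ≤ (F.L : ℝ) ^ 3 := one_le_pow₀ hL1
  have hε7 : 10 ^ 7 * (F.L : ℝ) ^ 3 * ε₀ ≤ 1 := by nlinarith
  have h1 : (1 : ℝ) ≤ 2 := by norm_num
  exact hSplitD_of_rows_of_plaqSmall F h hε₀ he hWe hWε U₀ hreg hb hHop hHR hq hRε h47 hQH h45L hA' hA'R hX hAX hX1 hε₀' hε' hplaq' _ Kop q hKsub (P₂ := 2) hC₀ hδ h1 hwin hT hQ4 hKT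
    (hPoinc_of_regPr F h cB hε₀ hε7 U₀ hreg) (hHZ_of_parallelLift F h hε₀ hWε U₀ hreg hLift)

end Summit.QuantumFields.YangMills.Theorems.Prop7HSplitDOfPlaqSmall

end
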